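import Literature.AnabelianGeometry.SemiGraphs.ThetaRayGraph
import HarnessLib

/-!
# No critical sub-joint from a separating character ([SemiAnbd] Thm 3.7 (iii) p. 41; `𝒢_θ` memo (2c))

Mochizuki, *Semi-graphs of anabelioids*, Publ. RIMS **42** (2006) [MochizukiSemiAnbd2006], §3,
Theorem 3.7 (iii), author's manuscript pp. 40–41, proof p. 41 (the sub-joint argument: "`H` acts
trivially on some subjoint … contained … in the intersection of the images of `π̂₁(𝒢_e)`, `π̂₁(𝒢_{e'})`
… since `𝒢` is totally estranged … `H` is trivial") [cite: MochizukiSemiAnbd2006, Thm 3.7(iii) p.41].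

PROOF-ONLY file (abc-iut-L3-d4; FRONTIER programme REFUTE-F1732 of plan/L3/SUBDAG-SemiAnbd-Thm37iii-REFUTE.md,
brick R6-level (c5): the ALGEBRAIC half of step (2c) of abc-iut-L3-d1's desk countermodel `𝒢_θ`, memo
COUNTERMODEL-Thm37iii-infinite.md sha16 8b26b5199c29f55f; towards a kernel erratum for the ∀-countable
reading of Thm 3.7 (iii); print proves finite `𝔾`, kernel p431007).  MODEL-FREE, ONE LEVEL, BINDER FORM:
a group `Γ` acting on a semi-graph `T` over the ray (`SemiGraph.ray`, brick R3), gluings `up`, `low k` of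
an edge group `E` into a vertex group `G` (the shape of `thetaRay G E up low`), and at a tree vertex `y`
over the position `k`:

* (hstab) a level decomposition homomorphism `ψ : G →* Γ` at `y` such that an element of `Γ` fixing a
  tree edge at `y` lying over the base branch `β` is the `ψ`-image of a CONJUGATE of an element of the
  branch subgroup of `β` (Bass–Serre local structure; cell item (c4));
* (hχ, hσ) an abelian character `χ : Γ →* A` restricting along `ψ` to a vertex character `χG`, with the
  value of the test element `σ` prescribed as `χG (up e₀)` (the "global character" of the memo; (c3));
* (hK) `ker ψ ≤ ker ab` for an abelian quotient `ab : G →* V` (deep level: point stabilisers inside the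
  characteristic core `G(p^{2e})`; brick R4's splitters);
* (hsep) the MODEL ARITHMETIC: elements `low k t₁`, `up t₂` with the prescribed character values have
  different images under `ab` (at `𝒢_θ`: `(u, p^{n_k} u) ≠ (u, 0)` in `(ℤ/p^e)²` for `n_k < e`; brick R2b),

then `σ` fixes NO pair of tree edges at `y` leading to the positions `k + 1` and `k - 1`
(`SemiGraph.ray_not_critical_of_characters`) — the `hcrit` input of
`VerticialLevelData.height_unbounded_of_criticalFree` at one vertex.  Nothing is asserted about any
particular graph or group; nothing here bears on [IUTchIII] Cor. 3.12 (IUT uses finite dual semi-graphs).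
-/

namespace Literature.AnabelianGeometry.SemiGraphs

namespace SemiGraph


/-- On the ray, a branch abutting to `k` whose edge has another branch abutting to `k + 1` is
`β_k⁻ = (k, false)`. [cite: MochizukiSemiAnbd2006, §1 p.11] -/
theorem ray_branch_eq_false_of_up {β β₂ : ℕ × Bool} {k : ℕ} (hβ : ray.abuts β = some k)
    (hne : β₂ ≠ β) (he : ray.edgeOf β₂ = ray.edgeOf β) (hβ₂ : ray.abuts β₂ = some (k + 1)) :
    β = (k, false) := by
  obtain ⟨m, s⟩ := β
  obtain ⟨m₂, s₂⟩ := β₂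
  have hm : m₂ = m := he
  subst hm
  have h1 : (if s then m₂ + 1 else m₂) = k := Option.some.inj hβ
  have h2 : (if s₂ then m₂ + 1 else m₂) = k + 1 := Option.some.inj hβ₂
  cases s <;> cases s₂ <;> simp only [Bool.false_eq_true, ↓reduceIte] at h1 h2
  · exact absurd rfl hne
  · rw [h1]
  · exfalso; omega
  · exact absurd rfl hne

/-- On the ray, a branch abutting to `k` whose edge has another branch abutting to `k - 1` (i.e. to `v₂`
with `v₂ + 1 = k`) is `β_{k-1}⁺ = (v₂, true)`. [cite: MochizukiSemiAnbd2006, §1 p.11] -/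
theorem ray_branch_eq_true_of_down {β β₂ : ℕ × Bool} {k v₂ : ℕ} (hβ : ray.abuts β = some k)
    (hne : β₂ ≠ β) (he : ray.edgeOf β₂ = ray.edgeOf β) (hβ₂ : ray.abuts β₂ = some v₂) (hv₂ : v₂ + 1 = k) :
    β = (v₂, true) := by
  obtain ⟨m, s⟩ := β
  obtain ⟨m₂, s₂⟩ := β₂
  have hm : m₂ = m := he
  subst hm
  have h1 : (if s then m₂ + 1 else m₂) = k := Option.some.inj hβ
  have h2 : (if s₂ then m₂ + 1 else m₂) = v₂ := Option.some.inj hβ₂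
  cases s <;> cases s₂ <;> simp only [Bool.false_eq_true, ↓reduceIte] at h1 h2
  · exact absurd rfl hne
  · exfalso; omega
  · have hm : m₂ = v₂ := by omega
    rw [hm]
  · exact absurd rfl hne

/-- **No critical sub-joint from a separating character** (the algebraic half of the memo's step (2c),
one level, binder form; [SemiAnbd] Thm 3.7 (iii) proof p. 41).  See the module docstring for the roles of
the hypotheses.  Conclusion: the `hcrit` shape of `VerticialLevelData.height_unbounded_of_criticalFree` at
the tree vertex `y` over the position `k`, for the automorphism `σT` by which `σ` acts.
[cite: MochizukiSemiAnbd2006, Thm 3.7(iii) p.41] -/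
theorem ray_not_critical_of_characters {Γ G E V A : Type*} [Group Γ] [Group G] [Group E]
    [CommGroup V] [CommGroup A] (T : SemiGraph.{0}) (π : T ⟶ ray) (σT : CategoryTheory.Aut T)
    (up : E →* G) (low : ℕ → (E →* G)) (ab : G →* V) (χG : G →* A) (χ : Γ →* A)
    (σ : Γ) (e₀ : E) (k : ℕ) (y : T.Vertex) (hy : π.vertexMap y = k) (ψ : G →* Γ)
    (hstab : ∀ b : T.Branch, T.abuts b = some y → σT.hom.edgeMap (T.edgeOf b) = T.edgeOf b →
      ∃ (f : G) (t : E), σ = ψ (f * (if (π.branchMap b).2 then up t else low (π.branchMap b).1 t) * f⁻¹))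
    (hχ : ∀ x : G, χ (ψ x) = χG x) (hσ : χ σ = χG (up e₀))
    (hK : ∀ x : G, ψ x = 1 → ab x = 1)
    (hsep : ∀ t₁ t₂ : E, χG (low k t₁) = χG (up e₀) → χG (up t₂) = χG (up e₀) →
      ab (low k t₁) ≠ ab (up t₂)) :
    ∀ (b b' : T.Branch), T.abuts b = some y → T.abuts b' = some y →
      σT.hom.edgeMap (T.edgeOf b) = T.edgeOf b → σT.hom.edgeMap (T.edgeOf b') = T.edgeOf b' →
      (∃ (b₂ : T.Branch) (v₂ : T.Vertex), b₂ ≠ b ∧ T.edgeOf b₂ = T.edgeOf b ∧ T.abuts b₂ = some v₂ ∧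
        π.vertexMap v₂ = k + 1) →
      (∃ (b₂ : T.Branch) (v₂ : T.Vertex), b₂ ≠ b' ∧ T.edgeOf b₂ = T.edgeOf b' ∧ T.abuts b₂ = some v₂ ∧
        π.vertexMap v₂ + 1 = k) → False := by
  intro b b' hb hb' he he' ⟨b₂, v₂, hb₂, he₂, hv₂, hk₂⟩ ⟨b₂', v₂', hb₂', he₂', hv₂', hk₂'⟩
  -- Step 1: the base branches are `β_k⁻` and `β_{k-1}⁺`
  have hπb : ray.abuts (π.branchMap b) = some k := hy ▸ π.abuts_branchMap b y hb
  have hπb' : ray.abuts (π.branchMap b') = some k := hy ▸ π.abuts_branchMap b' y hb'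
  have hβ : π.branchMap b = (k, false) :=
    ray_branch_eq_false_of_up hπb (fun h => hb₂ (π.branchMap_injOn b₂ b he₂ h))
      (by rw [π.edgeOf_branchMap, π.edgeOf_branchMap, he₂]) (hk₂ ▸ π.abuts_branchMap b₂ v₂ hv₂)
  have hβ' : π.branchMap b' = (π.vertexMap v₂', true) :=
    ray_branch_eq_true_of_down hπb' (fun h => hb₂' (π.branchMap_injOn b₂' b' he₂' h))
      (by rw [π.edgeOf_branchMap, π.edgeOf_branchMap, he₂']) (π.abuts_branchMap b₂' v₂' hv₂') hk₂'
  -- Step 2: `σ` is a conjugate of a `low k`-element and of an `up`-element, through `ψ`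
  obtain ⟨f₁, t₁, h₁⟩ := hstab b hb he
  obtain ⟨f₂, t₂, h₂⟩ := hstab b' hb' he'
  rw [hβ] at h₁
  rw [hβ'] at h₂
  simp only [Bool.false_eq_true, ↓reduceIte] at h₁ h₂
  -- Step 3: the character pins the exponents
  have hconjχ : ∀ (f x : G), χG (f * x * f⁻¹) = χG x := fun f x => by
    rw [map_mul, map_mul, map_inv, mul_inv_cancel_comm]
  have hχ₁ : χG (low k t₁) = χG (up e₀) := by rw [← hconjχ f₁, ← hχ, ← h₁, hσ]
  have hχ₂ : χG (up t₂) = χG (up e₀) := by rw [← hconjχ f₂, ← hχ, ← h₂, hσ]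
  -- Step 4: abelianise through `ker ψ ≤ ker ab`
  have hconjab : ∀ (f x : G), ab (f * x * f⁻¹) = ab x := fun f x => by
    rw [map_mul, map_mul, map_inv, mul_inv_cancel_comm]
  have hker : ψ ((f₁ * low k t₁ * f₁⁻¹) * (f₂ * up t₂ * f₂⁻¹)⁻¹) = 1 := by
    rw [map_mul, map_inv, ← h₁, ← h₂, mul_inv_cancel]
  have hab : ab (low k t₁) = ab (up t₂) := by
    have := hK _ hker
    rw [map_mul, map_inv, hconjab, hconjab, mul_inv_eq_one] at this
    exact this
  exact hsep t₁ t₂ hχ₁ hχ₂ hab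

end SemiGraph

end Literature.AnabelianGeometry.SemiGraphs
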